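import Summits.AtomisticToContinuum.FouriersLaw.Theses.OddSectorIrreversibility
import Literature.MathematicalPhysics.KineticTheory.LangevinChainGibbs
import Literature.MathematicalPhysics.KineticTheory.LangevinChainFlowBounds
import Literature.MathematicalPhysics.KineticTheory.LangevinChainEnergyIdentity

/-!
# Disproof workfile for crux `ClosedConeSensitivity` (E3, stmt-AtomisticToContinuum-14059, rank 4 of route OddSectorIrreversibility)

`E3`: `∃ a κ C` with, for all `N`, bonds `i`, contacts `b ∈ {0, N-1}`, `t ≤ a·d`, kicks `s ∈ (0,1]`,
`∫ (j_i(Φ_t(q, p + s e_b)) − j_i(Φ_t(q,p)))² e^{-H/T} dq dp ≤ C s² e^{-κ(d − t/a)} Z_N`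
(`Φ_t` = the zero-friction kernels = the CLOSED Hamiltonian flow; `d` = distance of bond `i` to `b`).

## Findings (refuter-cdisprove seat, cycle 1, 2026-08-16) — provers / planner please read §0–§6

§0 SHAPE (probe rc 0; `probe_shape`, `closedConeSensitivity_iff_det`). The zero-friction kernel IS
the Dirac mass at the deterministic flow (`transitionKernel_zero_friction`: noise amplitude
`√(2·0·T) = 0`, `pinnedChain_transitionKernel_apply` holds for `γ ≥ 0`), so the statement is the
honest finite-difference claim `ClosedConeSensitivityDet` about `detFlow`. No junk handle: `H`, `j`
do not depend on `γ` (`rfl`); `j_{N-1} ≡ 0` and the `ℕ`-truncated `d` only produce `LHS = 0`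
instances; the Bochner convention (`∫` of a non-integrable function `= 0`) could only HELP the claim
and is anyway moot — the integrand is integrable (`integrable_sqDiff`: energy conservation
`hamiltonian_detFlow`, `|j_i∘Φ_t| ≤ N(3+β)/2 (1+H)²`, `H(kick) ≤ 2H + s²`, Gaussian confinement).
`N ≤ 2` forces `t = 0`. At `t = 0` the claim is exact in its scalings: `LHS(i=b=0) = (s²/4)·∫V'(q₁−q₀)² e^{-H/T}`
(`bondCurrent_kick_contact`), so any admissible `C` satisfies `4C ≥ sup_N E_N[V'(r₀)²]`
(`contactForce_sq_le_of_closedConeSensitivity`) — non-vacuous, not trivially true, not misstated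
in the cheap sense. An independent attack seat (refuter-rattack-…-14059, item note 02:43Z) reached
the same shape verdict.

§1 THE LOAD-BEARING OBSERVATION (PROVED, `tangentConeBound_of_closedConeSensitivity`). Because the
bound carries `s²` for EVERY `s ∈ (0,1]`, Fatou along `s = 1/(n+1)` turns `E3` into
`TangentConeBound`: the SAME cone bound for `∫ liminf_n ((n+1) Δ_{1/(n+1)}(j_i∘Φ_t))² dμ_T`, i.e. for
the Gibbs mean square of ONE ENTRY `∂_{p_b}(j_i∘Φ_t)` OF THE TANGENT MAP `DΦ_t` (at every point of
differentiability; the flow of a polynomial field is smooth). The crux docstring's protection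
"finite differences, not derivatives, so rare hot corridors contribute bounded gain" is therefore
VOID: the `s → 0` corner is the derivative, whose gain is not bounded by the energy. And the `s²`
cannot be dropped by the planner: `WitnessGlue`'s leak term `γT Σ_b ⟨∂_{p_b}u⁺, ∂_{p_b}(j_i∘Φ_t)⟩`
is a pairing with exactly this derivative. (`boundedGain_of_closedConeSensitivity`: the bounded-gain
reading IS implied by `E3`, is plausibly true, and is useless for the glue.)

§2 WHY `E3` IS PROBABLY FALSE AT EVERY PARAMETER POINT (heuristic; the refutation interface is
`closedConeSensitivity_false_of_rayBlowup`, PROVED: blow-up of the normalised tangent mean square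
along the rays `t = a·d` for every slope `a`, `TangentRayBlowup`, at ONE admissible point kills `E3`).
Gibbs mean squares of tangent entries over times `≍ d` are generalised-Lyapunov (`L(2)`) objects
dominated by RARE initial data. In the quartic chain the local stretching rate is UNBOUNDED: the
leading-order dynamics of a hot `k`-site cluster at energy `e` per site is the homogeneous quartic
lattice, scale-covariant under `q ↦ Lq, t ↦ t/L, E ↦ L⁴E`, so its Lyapunov rate is `λ(e) = λ₁ e^{1/4}`;
its Gibbs cost `e^{-ke/T}` does NOT depend on `d`; above-band excitations are self-trapped
(breather-like), so the amplifier persists. (Which object amplifies: a single-site hard breather is a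
periodic orbit and may well be linearly stable — it shears phases only linearly in `t`; but it
drives its anharmonic neighbours periodically with force amplitude `≍ βA³ ≍ e^{3/4}` at frequency
`Ω ≍ e^{1/4}`, and a strongly driven Duffing oscillator is the textbook chaotic 1½-degree-of-freedom
system, so the breather's NEIGHBOURHOOD is a sustained chaotic layer with rate `≍ Ω` for as long as
the breather lives; multi-site hot clusters are chaotic outright. The kit job `hot.py` (j012710)
measures the local finite-time exponent and the energy retention of planted clusters directly.) On the ray `t = a·d` the amplified perturbation reaches
bond `d` through the cold harmonic-like medium with the precursor factor `≈ (e·v·a/2)^{2d}` only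
(EXPONENTIAL in `d`, Bessel tails), hence
  `M2(d, a·d) := Z⁻¹∫(∂_{p_0} j_d∘Φ_{ad})² e^{-H/T} ≳ e^{-ke/T} · exp( d·[2aλ₁e^{1/4} − 2 log(2/(e v a))] ) → ∞`
as soon as `e > e(a) := (log(2/(eva))/(aλ₁))⁴` — for EVERY `a > 0`, at a `d`-independent price.
So no slope `a` admits an `N`-uniform `C`; the violation sets in at `d ≳ k e(a)/(T·margin)`,
astronomically far for small `a` (invisible numerically) but at moderate `d` for `a ≈ 1/v_B`, where
in addition the TYPICAL chaotic front (butterfly speed `v_B`, broadening front) already makes the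
MEAN square on the edge grow. Hot CORRIDORS alone (supersonic transmission, `O(1)` gain, cost
`e^{-d·c/(θa)⁴T}` on `t = θ a d`) do NOT refute anything: `κ` small absorbs them. What survives in
print is almost-sure / typical: Buttà–Marchioro 2016 Thm 2.2 (tree fact
`ButtaMarchioro2016_thm22_chain`, a.s. super-exponential decay outside `|i−j| > t log^α t`, proved in
tree per the attack seat) — whose authors doubt even the a.s. LINEAR cone (p. 5) — nothing in `L²(Gibbs)`.
Rigorous status of §2: needs energy-growing positive Lyapunov exponents for small quartic clusters
embedded in a thermal chain + persistence; no rigorous chaos result of this kind exists (FPU-type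
chains), so `¬E3` is NOT provable today, and `E3` is not provable either if §2 is right.

§3 LOAD-BEARING HYPOTHESES (§5 of the file). `lam, β > 0`: NOT load-bearing (harmonic member satisfies
`E3` kinematically; anharmonicity is what endangers it). `s ≤ 1`: load-bearing
(`not_closedConeSensitivityAllKicks`, near-miss with the scaling proof in its docstring: large kicks give
`j_1 ≍ s^{5/2}` at `t = O(1)`). `t ≤ a·d`: dropping it asks for at most exponential growth in `t` at
fixed `d`; §2 predicts `exp(c t^{4/3})` (conjecturally false; measured by the kit jobs). The `s²`
factor: dropping it gives the (plausibly true, glue-useless) bounded-gain statement.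

§4 REPAIRS THAT DODGE §2 (for the planner; each changes WitnessGlue's bookkeeping): (R1) sub-linear
windows `t ≤ a√d` (the attack seat's "provable now" regime: Dyson series + generalised Hölder +
invariance of `μ_T`, losing `n^{n/2}`), giving `Σ_N ≍ N^{3/2}` instead of `N²` in the witness — the
Cauchy–Schwarz is then misaligned by `N^{1/4}`; (R2) move the derivative OFF the flow: integrate the
leak term by parts in `p_b` against the Gaussian momentum marginal so that only VALUES of `j_i∘Φ_t`
(bounded gain) are paired with `∂²_{p_b}u⁺ − (p_b/T)∂_{p_b}u⁺` — needs second-derivative control of the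
corrector instead of `E3`; (R3) a tempered statement `E[min((Δ_s j/s)², K²)]` or an `s`-floor
`s ≥ s₀(d) = e^{-κ'd}` — compatible with §2 but then the glue's Fatou step must be replaced by a
finite-`s` difference quotient of `u⁺`, i.e. by a Lipschitz-in-`p_b` bound on `u⁺` at scale `s₀(d)`.

§5 NUMERICS (kit, script `cone_job/main.py` in the seat folder; closed chain, Gibbs initial data by
checkerboard Metropolis + exact Gaussian momenta, velocity Verlet with its exact tangent map, `N = 128`):
`M2(d,t)` and `F2_s(d,t) = E[(Δ_s j_d∘Φ_t)²]/s²` for `s = 1, 0.1, 0.01`, `d ≤ 48`, with mean / median /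
quantiles / max / top-1%-share per `(d,t)`, ray tables `t = a·d` for `a ∈ {0.5,…,4}`, front-speed fits
(typical vs mean-square), and the correlation of `log M2` on the rays with the initial energy of sites
0–3. Jobs (resubmitted 05:40Z with an all-site BAOAB thermaliser after the checkerboard-Metropolis
versions j011333–j011350 proved too slow for the 0.5 h lane cap and were cancelled): j014142
(ω₂,lam,β)=(1,1,1) T=1 S=4000; j014315 same S=8000, N=112, t ≤ 64 (sample-size drift of the mean = tail dominance; S=16000 exceeds the lane's wall cap);
j014144 T=5; j014145 (1,1,0.1) T=8 (the route's diffusive point); j014146 harmonic control; j012710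
planted hot clusters (`hot.py`: Gibbs-weighted gain `w(e)+log G(e;d,ad)` on rays,
retention, local exponent). Queue was saturated at submission (results will be digested into this block
and attached to the item). The attack seat's j010948 (typical cone + hot-source amplifier) is complementary.
PREDICTIONS to be checked: (i) on rays with `1/a` at or below the butterfly speed the sample MEAN of
`(∂_{p_0}j_d∘Φ_{ad})²` grows with `d` while the MEDIAN decays; (ii) the mean is carried by the top 1% of
samples and drifts upward with `S`; (iii) `F2_1` saturates (bounded gain) where `M2` keeps growing;
(iv) harmonic control: mean ≈ median, clean linear cone, no tail.

RESULTS 1 — planted hot clusters, j012710 (`hot.py`; N = 96, S = 300, T = 1, (ω₂,lam,β) = (1,1,1),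
K = 3 contact sites given momenta ±√(2e), e ∈ {0,4,8,16,32,64}, closed flow to t = 60, exact tangent map
of the kick direction e_{p_0}; G(e;d,t) = sample mean of (∂_{p_0} j_d∘Φ_t)²):
 (a) PERSISTENCE: after a radiative transient (t ≲ 10) the energy inside sites 0–4 PLATEAUS at
     R = 0.38/0.21/0.15/0.10/0.10 of its initial value for e = 4/8/16/32/64, i.e. a hot spot retaining
     ≈ 5.7/5.7/7.5/10.3/19.7 energy units (thermal content ≈ 5.1) for the whole run — self-trapping.
 (b) SUSTAINED, ENERGY-GROWING AMPLIFICATION: the local finite-time exponent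
     Λ(t) = ⟨log‖tangent|_{sites 0–4}‖⟩/t at t = 60 is 0.031 (thermal) and 0.065/0.074/0.096/0.120/0.141
     for e = 4…64, still INCREASING in t for the hot cases (e = 64: 0.115 → 0.141 from t = 10 to 60);
     Λ − Λ_thermal ≈ 0.05·(retained excess)^{0.3}, in line with the `e^{1/4}` scaling of §2.
 (c) RAYS (least-squares slope per bond of log G(e; d, a·d), d ≥ 4; the Gibbs price of the hot spot is a
     d-INDEPENDENT offset): a = 0.5 (cone speed 2): all slopes ≈ −1.2 (outside every cone, nothing);
     a = 1.0 (speed 1, just OUTSIDE the measured mean-square front ≈ 0.9): thermal −0.09, e = 8/16: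
     +0.07, e = 32/64: +0.18; a = 1.5: thermal +0.13, hot +0.23/+0.33/+0.52/+0.50/+0.66; a = 2: +0.22 vs
     +0.32/+0.70/+0.73/+0.75/+1.30; a = 3: +0.34 vs +0.69/+1.06/+1.03/+1.60/+1.85 — on every ray with
     a ≥ 1 the growth rate along the ray INCREASES with the contact energy, so any fixed Gibbs price is
     overtaken at a finite d and the envelope over e of log M2(d, a·d) is superlinear in d. With the
     (pessimistic) planting price 3e/T the crossover on a = 1 is at d ≈ 110 (e = 8); with the price of
     the RETAINED excess (≈ 1–5 units) at d ≈ 50–80: the edge consequence of E3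
     (`edgeBound_of_closedConeSensitivity`) is predicted to fail at N ≈ 10² for slopes near the front
     speed — testable by importance sampling, invisible to plain sampling (prices e^{-5…-24}).
 (d) THERMAL ENSEMBLE (e = 0, S = 300): mean-square front speed ≈ 0.9 bonds/unit time against ≈ 0.8
     for the median / mean-log fronts (threshold 10⁻²); at the kicked bond the ratio mean/median of
     (∂_{p_0} j_0∘Φ_t)² rises from 9 (t = 0) to ≈ 100 (t = 60): the mean square is tail-dominated.
 Verdict of results 1: the two physical uncertainties of §2 (U1 sustained amplification with a rate
 growing with the hot-spot energy; U2 out-coupling to the cold medium — the far-bond G's grow with the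
 same enhanced rates) are SUPPORTED at T = 1; prediction (i) holds already for PLANTED hot contacts on
 the ray a = 1 where the thermal mean still decays.
RESULTS 2 — thermal ensemble, baseline (j014142: (ω₂,lam,β) = (1,1,1), T = 1, N = 128, S = 4000, t ≤ 80,
d ≤ 48; checks ⟨p²⟩ = 0.998, configurational virial 1.003, energy drift 1.8·10⁻⁴):
 (a) INTERMITTENCY IN TIME at fixed bond: growth rates over t ∈ [20,80] of E(∂_{p_0}j_d∘Φ_t)² (sample
     mean) 0.158/0.141/0.180 per unit time for d = 0/1/4 against 0.098/0.105/0.101 for the median (and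
     the mean-log): the mean square grows ≈ 1.6× faster than the typical square; at d = 0 the median does
     not move at all until t ≈ 30 (0.058 → 0.050) while the mean goes 0.33 → 2.7.
 (b) RAYS t = a·d, least-squares slope per bond (d ≥ 4) of log(mean) | log(median) | log(max sample):
     a = 0.5: −1.18 | −1.26 | −1.13;  a = 1.0: −0.10 | −0.18 | −0.09;  a = 1.5: +0.15 | +0.07 | +0.19;
     a = 2.0: +0.27 | +0.14 | +0.33;  a = 2.5: +0.37 | +0.20 | +0.44;  a = 3.0: +0.50 | +0.26 | +0.61.
     On every ray the mean separates from the typical value exponentially in d (by +0.08…+0.25 per bond);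
     at the far end mean/median = 516 / 1300 / 660 / 1142 / 788 / 2270 and the TOP 1 % OF SAMPLES CARRY
     82–97 % OF THE MEAN (Gaussian value: 8 %).
 (c) WHO ARE THE TOP 1 %: their initial energy on sites 0–3 is 4.9–6.8 against the ensemble mean 3.53
     (corr(log M2, E_{0–3}) = 0.2–0.4 on all rays): the samples that carry the mean square are those with
     a HOT CONTACT at time 0 — the mechanism of §2, seen directly.
 (d) BOUNDED GAIN AT FIXED KICK: F2_1 = E(Δ_1 j_d∘Φ_t)² saturates at ≈ 0.4–1.2 on every ray and at every
     d while F2_{0.01}/10⁻⁴ tracks M2 up to ≈ 10²–10³: sup_{s∈(0,1]} F2_s/s² is attained as s → 0, i.e.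
     numerically too the `s² ∀ s` form of E3 IS the tangent bound (§1), and the finite-kick statement the
     docstring had in mind is a different, bounded object.
 (e) FRONTS (largest d with statistic ≥ θ, fitted over t ≥ 10): median 0.82/0.87/0.91, mean-log
     0.83/0.86/0.90, q99 0.93/0.97/1.00, MEAN 0.92/0.98/1.02 bonds per unit time for θ = 10⁻²/10⁻⁴/10⁻⁶:
     the mean-square front outruns the typical front by ≈ 12 % at S = 4000 and its apparent speed rises as
     the threshold is lowered. For E3 the admissible slopes are therefore 1/a > 1.0 at this (S, t); on the
     marginal ray a = 1 the mean still decays, at −0.10 per bond — a rate set by the hottest of 4000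
     contacts, which RESULTS 1(c) shows turns positive (+0.07…+0.18) for contacts hotter than any sampled.
RESULTS 5 — harmonic control (j014146: lam = β = 0, S = 2000, T = 1): prediction (iv) confirmed exactly —
 mean/median ≡ 2.2 (the χ²₁ value) and top-1 % share ≡ 0.08 at every (d,t); F2_s ≡ M2 for all s; fronts
 0.60–0.69 for every statistic (= the maximal group velocity 0.62 of ω(k)² = 1 + 2(1 − cos k)); ray
 a = 0.5: −2.0 per bond (super-exponential regime), a = 1: −0.6, a = 1.5 (speed 0.67 ≈ v_max): bounded
 ≈ 10⁻³, a = 2: bounded ≤ 0.12. So E3 holds kinematically for the harmonic member (1/a ≳ 0.7), and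
 EVERY heavy-tail feature of RESULTS 1–2 is an effect of anharmonicity.
RESULTS 3 — hotter point (j014144: (1,1,1), T = 5, N = 128, S = 4000, dt = 0.01, t ≤ 50; checks ⟨p²⟩ = 4.98,
 virial 4.98, drift 1.1·10⁻⁴): the same picture, amplified. Growth rates in t (t ∈ [10,50]) mean 0.39/0.41/0.39
 vs median 0.23/0.23/0.23 (d = 0/1/4); ray slopes per bond mean | median | max: a = 0.5: −0.65 | −0.81 | −0.64;
 a = 1: +0.22 | +0.08 | +0.27; a = 1.5: +0.57 | +0.27 | +0.66; a = 2: +0.76 | +0.42 | +0.87; a = 3: +1.18 | +0.71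
 | +1.31; mean/median at the far ends 8·10⁴ / 2·10⁴ / 10⁵ / 7·10³; TOP-1 % SHARE 0.95–1.00 on every ray (the
 entire Gibbs mean square is made by ≤ 40 of 4000 samples); those samples start with contact energy 22–31
 against the mean 16.6. F2_1 saturates at ≈ 50–60 (the bounded-gain level, ∝ T²) while F2_{0.01} reaches
 2·10⁵. Fronts: median 1.13/1.17/1.21, MEAN 1.31/1.34/1.47, q99 1.30/1.34/1.37 (θ = 10⁻²/10⁻⁴/10⁻⁶): the
 mean-square front outruns the typical one by 16–21 % and its apparent speed keeps rising as θ ↓.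
RESULTS 2b — sample-size dependence at T = 1 (S = 300: j012710 e = 0, N = 96; S = 4000: j014142; S = 8000:
 j014315, N = 112, t ≤ 64; checks ⟨p²⟩ = 1.001, virial 0.999): MEDIANS agree to ±0.1 nat at every (a, d);
 MEANS at S = 4000 and 8000 agree within their noise (±0.5 nat; ray slopes a = 1: −0.068/−0.070, a = 1.5:
 +0.124/+0.136, a = 2: +0.256/+0.250 per bond over d ∈ [4,32]; mean fronts 0.92/0.98/1.02 vs 0.94/0.98/1.00)
 and both exceed the S = 300 means by 0.3–1.5 nat on the rays a ≥ 1.5; growth in t at d = 0: mean 0.19/0.15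
 vs median 0.09/0.09 (S = 4000/8000). Reading: the sampled mean is controlled by the ≈ 1 % hot-contact
 samples, a population already stable between S = 4000 and 8000; the next class of events (the planted
 clusters of RESULTS 1, Gibbs price e^{−5…−24}) is out of reach of plain sampling, so the S-drift is
 undetectable here and the asymptotic statement rests on RESULTS 1(c) (growth rates along rays increasing
 with the contact energy) — an importance-sampling run at N ≈ 200–400 is the decisive experiment.
RESULTS 4 — the route's diffusive point (j014145: (ω₂,lam,β) = (1,1,0.1), T = 8, N = 128, S = 4000, dt = 0.01,
 t ≤ 50; checks ⟨p²⟩ = 7.995, virial 8.008, drift 6·10⁻⁵): the STRONGEST intermittency of the set. Growth in t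
 (t ∈ [10,50]): mean 0.52/0.45/0.49 vs median 0.19/0.20/0.22 (d = 0/1/4) — ratio 2.4; top-1 % share = 1.00 at
 d ≤ 4, t = 50. Fronts: median 0.63/0.66/0.67, mean 0.70/0.71/0.73, q99 0.69/0.72/0.74. Ray slopes per bond
 mean | median | max: a = 0.5: −1.93 | −2.01 | −1.90; a = 1: −0.59 | −0.69 | −0.55; a = 1.5 (speed 0.67 = the
 typical front): +0.025 | −0.081 | +0.074 — ON THIS RAY THE TYPICAL SQUARE DECAYS WHILE THE GIBBS MEAN SQUARE
 GROWS, prediction (i) realised inside a plainly sampled thermal ensemble; a = 2: +0.36 | +0.21; a = 3: +0.91 |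
 +0.51; a = 4: +1.70 | +0.82. Here the carrying samples are only mildly hotter at the contact (29–35 vs 26.9;
 corr ≈ 0.1): with strong pinning the amplifiers sit anywhere along the path. F2_1 saturates at 25–43.

NUMERICS VERDICT (T = 1, 5 and the diffusive point; harmonic control clean). Every qualitative prediction of
§2 that plain sampling can reach is seen: (i) mean vs median separate exponentially in t and along every
ray, up to a ray where the median decays and the mean grows (RESULTS 4, a = 1.5); (ii) the mean is carried
by ≤ 1 % of the samples — hot contacts (T = 1, 5) or hot spots along the path (diffusive point) — with no
detectable drift between S = 4000 and 8000 because the next class of events costs e^{−5…−24}; (iii) finite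
kicks saturate, the `s → 0` corner tracks the tangent map, so E3 as typed IS the tangent bound; (iv) the
harmonic member is Gaussian with a sharp cone at v_max. Planted clusters (RESULTS 1) supply what sampling
cannot: persistent hot contacts whose ray growth rates increase with their energy on every ray a ≥ 1, so the
d-independent Gibbs price is overtaken at finite d (≈ 50–110 on the marginal ray at T = 1). What the
numerics do NOT show: a violation at slopes 1/a well above the mean-square front (a = 0.5): there all
statistics decay fast and the predicted violators are astronomically rare — E3 restricted to such slopes is
numerically unfalsifiable and, by §2, still expected to fail only at enormous d. For the route this is moot:
WitnessGlue needs Σ_N ≍ aN², any a > 0, so a prover may retreat to small a — where nothing is known either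
way and the only available proof technique (pathwise Gronwall / Dyson series in L²(Gibbs)) reaches t ≲ a√d
(attack seat), not t ≤ a·d.

§6 KERNEL-CHECKED CONTENT (this file; rc 0, ONE `sorry` = the near-miss of §3):
 * §1 dictionary: `detFlow`, `solMap_zero_friction`, `transitionKernel_zero_friction`,
   `integral_transitionKernel_zero_friction`, `detFlow_of_nonpos`, `continuous_detFlow`,
   `hamiltonian_detFlow` (energy conservation), `hamiltonian_indep_friction`, `bondCurrent_indep_friction`;
 * §0 `probe_shape` (`Iff.rfl`), `ClosedConeSensitivityDet`, `closedConeSensitivity_iff_det`;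
 * §2 `integrand_time_zero`, `bondCurrent_kick_contact`, `bondCurrent_kick_far`,
   `contactForce_sq_le_of_closedConeSensitivity` (tightness of the `s²·Z` scaling at `t = 0`);
 * §3 `TangentConeBound`, `abs_bondCurrent_detFlow_le`, `hamiltonian_kick_le`,
   `integrable_one_add_hamiltonian_pow_four_mul_exp`, `sqDiff_le`, `integrable_sqDiff`,
   `tangentConeBound_of_closedConeSensitivity` (E3 ⇒ tangent bound, Fatou);
 * §4 `TangentRayBlowup`, `closedConeSensitivity_false_of_rayBlowup` (refutation interface);
 * §5 `ClosedConeSensitivityAllKicks/NoCone/BoundedGain`, the bookkeeping implications, and the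
   near-miss `not_closedConeSensitivityAllKicks` (sorry, scaling proof in the docstring).
 LANDED / PROPOSED on the Negative lane (sorry-free; there the closed Props of this file are PARAMETRISED
 predicates — `ConeBoundAt ω₂ lam β γ T a κ C` for the body of `ClosedConeSensitivityDet`, `TangentBoundAt …`
 for the body of `TangentConeBound` — because a closed `def : Prop` in `Theorems/` is relocated to
 `Literature/` as a named fact, p80519/p80524 bounced for that reason):
 * `Theorems/ClosedConeSensitivity/Negative/ZeroFrictionDictionary.lean` — §1 + §0 + §2: ACCEPTED p80812
   (commit e0cbb9776fee);
 * `Theorems/ClosedConeSensitivity/Negative/TangentReduction.lean` — §3 + `edgeBound_of_closedConeSensitivity`: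
   ACCEPTED p82694 (commit 55916e61de1d). The conditional refutation
   `closedConeSensitivity_false_of_rayBlowup` stays HERE only: on the Theorems lane a refuter's
   `H → ¬E3` is accepted solely as `--negative-modulo H` (which would HOLD the item on the conjecture
   `TangentRayBlowup` — not appropriate for a physical heuristic), and as a plain proof it bounces
   ("Theorems is prover-only", p82562).

§7 WHAT WOULD CHANGE THIS ASSESSMENT (for provers). `E3` becomes plausible again iff local energy
fluctuations of the closed chain are NOT persistent amplifiers, i.e. iff (a) planted hot clusters lose
their excess energy on an `O(1)` time scale (retention `R(t) → O(T/e)` fast) or (b) their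
neighbourhood's finite-time exponent `Λ(e,t)` does not grow with `e`. Then the stretching-rate
fluctuations are effectively i.i.d. in time with tail `e^{-c r⁴/T}`, the generalised exponent `L₂(v)`
is finite, a finite mean-square front speed `v₂` exists, and `E3` holds with any `1/a > v₂` — the
proof pattern would be a BCDM/Buttà–Marchioro Gronwall in `L^{2}(Gibbs)` with a martingale-type
control of the time-integrated local curvature (not the pathwise sup). The kit job j012710 decides
between the two pictures at `T = 1`; j011333/4 show whether the mean-square front at accessible `d`
already outruns the typical front. Harmonic sanity check (why `lam, β` are not load-bearing): for a
banded generator with `‖A‖ ≤ K`, `|(e^{tA})_{0d}| ≤ (Kt)^d e^{Kt}/d!`, so on `t = θad`,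
`M2 ≲ exp(d[log(Kθae) + Kθa])`, and `E3` holds with any `a` such that `log(Kae) + Ka ≤ 0`, `κ = 1`
(using `log θ ≤ -(1-θ)`), given `N`-uniform Gibbs second moments of `r_d`, `p_d`.

-- Targets: none yet (payload.targets = []; no line picked, no stubs).
-/

noncomputable section

namespace Summit.AtomisticToContinuum.FouriersLaw.Cruxes.ClosedConeSensitivity.Disproof

open MeasureTheory Filter Topology ProbabilityTheory
open scoped NNReal ENNReal
open Literature.MathematicalPhysics.KineticTheory.HeatConduction
open Literature.Probability.Process
open Summit.AtomisticToContinuum.FouriersLaw.Theses.OddSectorIrreversibility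

/-! ## §1 the closed flow behind the zero-friction kernels -/

/-- The deterministic (closed, isolated) Hamiltonian flow of the pinned chain: the pathwise
solution `chainFlow` of `LangevinChainSDE` driven by the ZERO noise path. -/
def detFlow (ω₂ lam β : ℝ) (N : ℕ) (t : ℝ) (x : PhaseSpace N) : PhaseSpace N :=
  (pinnedChain ω₂ lam β 0).chainFlow N x (fun _ _ => 0) t

/-- At zero friction the noise amplitudes vanish and the noise path is identically zero. -/
theorem chainNoise_zero_amp (N : ℕ) (w : WienerPair) : chainNoise N 0 0 w = fun _ _ => 0 := by
  funext t i
  simp [chainNoise]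

/-- The solution map of the zero-friction chain is the deterministic flow, for every driving pair. -/
theorem solMap_zero_friction (ω₂ lam β : ℝ) (N : ℕ) (T_L T_R t : ℝ) (x : PhaseSpace N) (w : WienerPair) :
    (pinnedChain ω₂ lam β 0).solMap N T_L T_R t x w = detFlow ω₂ lam β N t x := by
  unfold OscillatorChain.solMap detFlow
  have hγ : (pinnedChain ω₂ lam β 0).γ = 0 := rfl
  rw [hγ]
  simp only [mul_zero, zero_mul, Real.sqrt_zero]
  rw [chainNoise_zero_amp]

variable {ω₂ lam β : ℝ} (hω : 0 < ω₂) (hl : 0 ≤ lam) (hβ : 0 ≤ β)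
include hω hl hβ

/-- **The zero-friction transition kernel is the Dirac mass at the deterministic flow.** -/
theorem transitionKernel_zero_friction (N : ℕ) (T_L T_R : ℝ) (t : ℝ≥0) (x : PhaseSpace N) :
    (pinnedChain ω₂ lam β 0).transitionKernel N T_L T_R t x = Measure.dirac (detFlow ω₂ lam β N t x) := by
  rw [pinnedChain_transitionKernel_apply hω hl hβ le_rfl N T_L T_R t x]
  have h : (fun ω : WienerPair => (pinnedChain ω₂ lam β 0).solMap N T_L T_R t x (pairPath ω)) =
      fun _ => detFlow ω₂ lam β N t x := funext fun ω => solMap_zero_friction ω₂ lam β N T_L T_R t x _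
  rw [h, Measure.map_const, measure_univ, one_smul]

/-- Integrals against the zero-friction kernels are evaluations along the deterministic flow. -/
theorem integral_transitionKernel_zero_friction (N : ℕ) (T_L T_R : ℝ) (t : ℝ≥0) (x : PhaseSpace N)
    (g : PhaseSpace N → ℝ) :
    ∫ y, g y ∂((pinnedChain ω₂ lam β 0).transitionKernel N T_L T_R t x) = g (detFlow ω₂ lam β N t x) := by
  rw [transitionKernel_zero_friction hω hl hβ, integral_dirac]

omit hω hl hβ in
/-- The deterministic flow at time `≤ 0` is the identity. -/
theorem detFlow_of_nonpos (N : ℕ) {t : ℝ} (ht : t ≤ 0) (x : PhaseSpace N) : detFlow ω₂ lam β N t x = x := by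
  unfold detFlow
  rw [pinnedChain_chainFlow_of_nonpos ω₂ lam β 0 N x continuous_const ht]
  ext i <;> simp

/-- The deterministic flow is continuous in the initial condition. -/
theorem continuous_detFlow (N : ℕ) (t : ℝ) : Continuous (detFlow ω₂ lam β N t) :=
  pinnedChain_continuous_chainFlow_left hω hl hβ le_rfl N continuous_const t

/-- **Energy conservation** along the deterministic flow (the pathwise energy identity with zero
noise and zero friction). -/
theorem hamiltonian_detFlow (N : ℕ) {t : ℝ} (ht : 0 ≤ t) (x : PhaseSpace N) :
    (pinnedChain ω₂ lam β 0).hamiltonian N (detFlow ω₂ lam β N t x) = (pinnedChain ω₂ lam β 0).hamiltonian N x := by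
  unfold detFlow
  rw [pinnedChain_hamiltonian_chainFlow_eq hω hl hβ le_rfl N x continuous_const ht]
  have hγ : (pinnedChain ω₂ lam β 0).γ = 0 := rfl
  simp [OscillatorChain.noiseWork, OscillatorChain.dissipation, hγ]


omit hω hl hβ in
/-- The Hamiltonian does not depend on the friction constant. -/
theorem hamiltonian_indep_friction (γ : ℝ) (N : ℕ) :
    (pinnedChain ω₂ lam β γ).hamiltonian N = (pinnedChain ω₂ lam β 0).hamiltonian N := rfl

omit hω hl hβ in
/-- The bond currents do not depend on the friction constant. -/
theorem bondCurrent_indep_friction (γ : ℝ) (N : ℕ) :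
    (pinnedChain ω₂ lam β γ).bondCurrent N = (pinnedChain ω₂ lam β 0).bondCurrent N := rfl

/-! ## §0 the crux, verbatim, and read through the dictionary -/

omit hω hl hβ in
/-- The crux elaborates and has the displayed shape (refuter probe, rc 0). -/
theorem probe_shape : ClosedConeSensitivity ↔
    ∀ ω₂ lam β γ : ℝ, 0 < ω₂ → 0 < lam → 0 < β → 0 < γ → ∀ T : ℝ, 0 < T → ∃ a κ C : ℝ, 0 < a ∧ 0 < κ ∧ ∀ (N : ℕ) (i b : Fin N) (t s : ℝ), (b.val = 0 ∨ b.val = N - 1) → 0 ≤ t → 0 < s → s ≤ 1 → let P := Literature.MathematicalPhysics.KineticTheory.HeatConduction.pinnedChain ω₂ lam β γ; let P₀ := Literature.MathematicalPhysics.KineticTheory.HeatConduction.pinnedChain ω₂ lam β 0; let μT : MeasureTheory.Measure (Literature.MathematicalPhysics.KineticTheory.HeatConduction.PhaseSpace N) := MeasureTheory.volume.withDensity (fun x : Literature.MathematicalPhysics.KineticTheory.HeatConduction.PhaseSpace N => ENNReal.ofReal (Real.exp (-(P.hamiltonian N x) / T))); let d : ℕ := (if b.val = 0 then i.val else N - 2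 - i.val); t ≤ a * (d : ℝ) → ∫ x, ((∫ y, P.bondCurrent N i y ∂(P₀.transitionKernel N T T t.toNNReal (x.1, Function.update x.2 b (x.2 b + s)))) - (∫ y, P.bondCurrent N i y ∂(P₀.transitionKernel N T T t.toNNReal x))) ^ 2 ∂μT ≤ C * s ^ 2 * Real.exp (-(κ * ((d : ℝ) - t / a))) * ∫ x, Real.exp (-(P.hamiltonian N x) / T) ∂MeasureTheory.volume :=
  Iff.rfl

/-- `E3` read through the dictionary of §1: the kernel integrals are evaluations along the closed
deterministic flow `detFlow`, so the left-hand side is the Gibbs mean square of a FINITE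
DIFFERENCE of `j_i ∘ Φ_t` under a momentum kick of size `s` at the contact `b`. -/
def ClosedConeSensitivityDet : Prop :=
  ∀ ω₂ lam β γ : ℝ, 0 < ω₂ → 0 < lam → 0 < β → 0 < γ → ∀ T : ℝ, 0 < T → ∃ a κ C : ℝ, 0 < a ∧ 0 < κ ∧
    ∀ (N : ℕ) (i b : Fin N) (t s : ℝ), (b.val = 0 ∨ b.val = N - 1) → 0 ≤ t → 0 < s → s ≤ 1 →
      let P := pinnedChain ω₂ lam β γ
      let μT : Measure (PhaseSpace N) :=
        volume.withDensity (fun x => ENNReal.ofReal (Real.exp (-(P.hamiltonian N x) / T)))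
      let d : ℕ := (if b.val = 0 then i.val else N - 2 - i.val)
      t ≤ a * (d : ℝ) →
        ∫ x, (P.bondCurrent N i (detFlow ω₂ lam β N t (x.1, Function.update x.2 b (x.2 b + s))) -
              P.bondCurrent N i (detFlow ω₂ lam β N t x)) ^ 2 ∂μT
          ≤ C * s ^ 2 * Real.exp (-(κ * ((d : ℝ) - t / a))) * ∫ x, Real.exp (-(P.hamiltonian N x) / T) ∂volume

omit hω hl hβ in
/-- **Dictionary.** `E3` is literally the finite-difference statement about the closed flow. -/
theorem closedConeSensitivity_iff_det : ClosedConeSensitivity ↔ ClosedConeSensitivityDet := by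
  unfold ClosedConeSensitivity ClosedConeSensitivityDet
  constructor
  · intro h ω₂ lam β γ hω hl hβ hγ T hT
    obtain ⟨a, κ, C, ha, hκ, H⟩ := h ω₂ lam β γ hω hl hβ hγ T hT
    refine ⟨a, κ, C, ha, hκ, fun N i b t s hb ht hs hs1 => ?_⟩
    have H' := H N i b t s hb ht hs hs1
    simp only [integral_transitionKernel_zero_friction hω hl.le hβ.le, Real.coe_toNNReal _ ht] at H' ⊢
    exact H'
  · intro h ω₂ lam β γ hω hl hβ hγ T hT
    obtain ⟨a, κ, C, ha, hκ, H⟩ := h ω₂ lam β γ hω hl hβ hγ T hT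
    refine ⟨a, κ, C, ha, hκ, fun N i b t s hb ht hs hs1 => ?_⟩
    have H' := H N i b t s hb ht hs hs1
    simp only [integral_transitionKernel_zero_friction hω hl.le hβ.le, Real.coe_toNNReal _ ht] at H' ⊢
    exact H'

/-! ## §2 time zero: the statement is non-vacuous and its `s² · Z` scaling is exact there -/

omit hω hl hβ in
/-- At `t = 0` the integrand of `E3` is the static finite difference of the current. -/
theorem integrand_time_zero (γ : ℝ) (N : ℕ) (i b : Fin N) (s : ℝ) (x : PhaseSpace N) :
    (pinnedChain ω₂ lam β γ).bondCurrent N i (detFlow ω₂ lam β N 0 (x.1, Function.update x.2 b (x.2 b + s))) -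
      (pinnedChain ω₂ lam β γ).bondCurrent N i (detFlow ω₂ lam β N 0 x)
    = (pinnedChain ω₂ lam β γ).bondCurrent N i (x.1, Function.update x.2 b (x.2 b + s)) -
      (pinnedChain ω₂ lam β γ).bondCurrent N i x := by
  rw [detFlow_of_nonpos N le_rfl, detFlow_of_nonpos N le_rfl]

omit hω hl hβ in
/-- Kicking the contact momentum `p_0` by `s` changes the contact current `j_0` by
`-(s/2) V'(q_1 - q_0)` (and nothing else enters at `t = 0`). -/
theorem bondCurrent_kick_contact (γ : ℝ) {N : ℕ} (h2 : 2 ≤ N) (x : PhaseSpace N) (s : ℝ) :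
    (pinnedChain ω₂ lam β γ).bondCurrent N ⟨0, by omega⟩
        (x.1, Function.update x.2 ⟨0, by omega⟩ (x.2 ⟨0, by omega⟩ + s)) -
      (pinnedChain ω₂ lam β γ).bondCurrent N ⟨0, by omega⟩ x
    = -(s / 2 * deriv (pinnedChain ω₂ lam β γ).V (x.1 ⟨1, by omega⟩ - x.1 ⟨0, by omega⟩)) := by
  unfold OscillatorChain.bondCurrent
  rw [← Finset.sum_sub_distrib, Finset.sum_eq_single ⟨1, by omega⟩]
  · have h10 : (⟨1, by omega⟩ : Fin N) ≠ ⟨0, by omega⟩ := by simp [Fin.ext_iff]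
    simp only [zero_add, ↓reduceIte, Function.update_self, Function.update_of_ne h10]
    ring
  · intro j _ hj
    have : ¬ (j.val = 0 + 1) := fun h => hj (Fin.ext (by simpa using h))
    simp [this]
  · intro h; exact absurd (Finset.mem_univ _) h

omit hω hl hβ in
/-- A kick at `p_b` is invisible at time `0` to every bond not containing the site `b`. -/
theorem bondCurrent_kick_far (γ : ℝ) {N : ℕ} (i b : Fin N) (hb : b.val ≠ i.val) (hb' : b.val ≠ i.val + 1)
    (x : PhaseSpace N) (s : ℝ) :
    (pinnedChain ω₂ lam β γ).bondCurrent N i (x.1, Function.update x.2 b (x.2 b + s)) =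
      (pinnedChain ω₂ lam β γ).bondCurrent N i x := by
  unfold OscillatorChain.bondCurrent
  refine Finset.sum_congr rfl fun j _ => ?_
  by_cases hj : j.val = i.val + 1
  · have hjb : j ≠ b := fun h => hb' (by rw [← h]; exact hj)
    have hib : i ≠ b := fun h => hb (by rw [h])
    simp only [hj, ↓reduceIte, Function.update_of_ne hib, Function.update_of_ne hjb]
  · simp [hj]

omit hl hβ in
/-- **Tightness at `t = 0` / what `C` must dominate.** Any constant `C` admissible in `E3`
bounds the `N`-uniform Gibbs second moment of the contact force:
`∫ V'(q_1 - q_0)² e^{-H/T} ≤ 4 C · Z_N` for every `N ≥ 2` (take `i = b = 0`, `t = 0`, `s = 1`).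
So the `s²·Z` scaling of the right-hand side is exact at `t = 0` and `E3` is not vacuous. -/
theorem contactForce_sq_le_of_closedConeSensitivity (hE3 : ClosedConeSensitivity) {γ : ℝ} (hγ : 0 < γ)
    (hl' : 0 < lam) (hβ' : 0 < β) {T : ℝ} (hT : 0 < T) :
    ∃ C : ℝ, ∀ (N : ℕ) (h2 : 2 ≤ N),
      ∫ x, (deriv (pinnedChain ω₂ lam β γ).V (x.1 ⟨1, by omega⟩ - x.1 ⟨0, by omega⟩)) ^ 2
          ∂(volume.withDensity (fun x : PhaseSpace N =>
              ENNReal.ofReal (Real.exp (-((pinnedChain ω₂ lam β γ).hamiltonian N x) / T))))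
        ≤ 4 * C * ∫ x : PhaseSpace N, Real.exp (-((pinnedChain ω₂ lam β γ).hamiltonian N x) / T) ∂volume := by
  obtain ⟨a, κ, C, ha, hκ, H⟩ := (closedConeSensitivity_iff_det.mp hE3) ω₂ lam β γ hω hl' hβ' hγ T hT
  refine ⟨C, fun N h2 => ?_⟩
  have H0 := H N ⟨0, by omega⟩ ⟨0, by omega⟩ 0 1 (Or.inl rfl) le_rfl one_pos le_rfl
  simp only [↓reduceIte, CharP.cast_eq_zero, mul_zero, le_refl, zero_div, sub_zero, neg_zero,
    Real.exp_zero, mul_one, one_pow, forall_const] at H0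
  have key : ∀ x : PhaseSpace N,
      ((pinnedChain ω₂ lam β γ).bondCurrent N ⟨0, by omega⟩
          (detFlow ω₂ lam β N 0 (x.1, Function.update x.2 ⟨0, by omega⟩ (x.2 ⟨0, by omega⟩ + 1))) -
        (pinnedChain ω₂ lam β γ).bondCurrent N ⟨0, by omega⟩ (detFlow ω₂ lam β N 0 x)) ^ 2 =
      (1 / 4) * (deriv (pinnedChain ω₂ lam β γ).V (x.1 ⟨1, by omega⟩ - x.1 ⟨0, by omega⟩)) ^ 2 := by
    intro x
    rw [integrand_time_zero, bondCurrent_kick_contact γ h2 x 1]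
    ring
  simp only [key, integral_const_mul] at H0
  linarith


/-! ## §3 the load-bearing observation: `E3` is a bound on the mean-square TANGENT map

`E3` carries the factor `s²` for EVERY `s ∈ (0,1]`. Dividing by `s²` and letting `s = 1/(n+1) → 0`,
Fatou's lemma turns `E3` into an `N`-uniform bound on `∫ liminf_n ((n+1) Δ_{1/(n+1)} (j_i∘Φ_t))² dμ_T`,
i.e. (wherever `p_b ↦ j_i(Φ_t(q, p))` is differentiable — everywhere, the flow of a polynomial field
being smooth, a fact not needed below) on `∫ (∂_{p_b}(j_i∘Φ_t))² dμ_T`, the Gibbs mean square of ONE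
ENTRY OF THE TANGENT MAP `DΦ_t`. So "finite differences, hence bounded gain from rare hot corridors"
(the crux docstring) buys nothing: every proof of `E3` proves the tangent bound `TangentConeBound`,
and every violation of the tangent bound refutes `E3`. -/

/-- The **mean-square tangent cone bound** implied by `E3` (Fatou form, no differentiability
needed): same quantifier prefix and constants as `E3`; the integrand is
`liminf_{n→∞} (n+1)² (j_i(Φ_t(q, p + e_b/(n+1))) - j_i(Φ_t(q,p)))²`, which is
`(∂_{p_b} (j_i ∘ Φ_t))²` at every point of differentiability. -/
def TangentConeBound : Prop :=
  ∀ ω₂ lam β γ : ℝ, 0 < ω₂ → 0 < lam → 0 < β → 0 < γ → ∀ T : ℝ, 0 < T → ∃ a κ C : ℝ, 0 < a ∧ 0 < κ ∧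
    ∀ (N : ℕ) (i b : Fin N) (t : ℝ), (b.val = 0 ∨ b.val = N - 1) → 0 ≤ t →
      let P := pinnedChain ω₂ lam β γ
      let μT : Measure (PhaseSpace N) :=
        volume.withDensity (fun x => ENNReal.ofReal (Real.exp (-(P.hamiltonian N x) / T)))
      let d : ℕ := (if b.val = 0 then i.val else N - 2 - i.val)
      t ≤ a * (d : ℝ) →
        ∫⁻ x, Filter.liminf (fun n : ℕ => ENNReal.ofReal (((n : ℝ) + 1) ^ 2 *
            (P.bondCurrent N i (detFlow ω₂ lam β N t (x.1, Function.update x.2 b (x.2 b + 1 / ((n : ℝ) + 1)))) -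
              P.bondCurrent N i (detFlow ω₂ lam β N t x)) ^ 2)) Filter.atTop ∂μT
          ≤ ENNReal.ofReal (C * Real.exp (-(κ * ((d : ℝ) - t / a))) *
              ∫ x, Real.exp (-(P.hamiltonian N x) / T) ∂volume)

/-- Polynomial energy bound for the current transported along the closed flow:
`|j_i(Φ_t y)| ≤ N (3+β)/2 (1 + H(y))²` (energy conservation + `pinnedChain_abs_bondCurrent_le`). -/
theorem abs_bondCurrent_detFlow_le (γ : ℝ) (N : ℕ) (i : Fin N) {t : ℝ} (ht : 0 ≤ t) (y : PhaseSpace N) :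
    |(pinnedChain ω₂ lam β γ).bondCurrent N i (detFlow ω₂ lam β N t y)| ≤
      N * ((3 + β) / 2 * (1 + (pinnedChain ω₂ lam β γ).hamiltonian N y) ^ 2) := by
  have h := pinnedChain_abs_bondCurrent_le hω.le hl hβ (0 : ℝ) N i (detFlow ω₂ lam β N t y)
  rw [hamiltonian_detFlow hω hl hβ N ht y] at h
  rw [bondCurrent_indep_friction, hamiltonian_indep_friction]
  exact h

omit hω hl hβ in
/-- A momentum kick is an added unit vector. -/
theorem update_eq_add_single {N : ℕ} (p : Fin N → ℝ) (b : Fin N) (s : ℝ) :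
    Function.update p b (p b + s) = p + Pi.single b s := by
  funext i
  by_cases h : i = b
  · subst h; simp
  · simp [Function.update_of_ne h, Pi.single_eq_of_ne h]

/-- Energy of the kicked state: `H(q, p + s e_b) = H(q,p) + p_b s + s²/2 ≤ 2 H(q,p) + s²`. -/
theorem hamiltonian_kick_le (γ : ℝ) (N : ℕ) (x : PhaseSpace N) (b : Fin N) (s : ℝ) :
    (pinnedChain ω₂ lam β γ).hamiltonian N (x.1, Function.update x.2 b (x.2 b + s)) ≤
      2 * (pinnedChain ω₂ lam β γ).hamiltonian N x + s ^ 2 := by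
  rw [update_eq_add_single, (pinnedChain ω₂ lam β γ).hamiltonian_add_momentum N x (Pi.single b s)]
  have hsum : ∑ i, (x.2 i * (Pi.single b s : Fin N → ℝ) i + (Pi.single b s : Fin N → ℝ) i ^ 2 / 2) =
      x.2 b * s + s ^ 2 / 2 := by
    rw [Finset.sum_eq_single b]
    · simp
    · intro i _ hi; simp [Pi.single_eq_of_ne hi]
    · intro h; exact absurd (Finset.mem_univ _) h
  rw [hsum]
  have hp : x.2 b ^ 2 ≤ 2 * (pinnedChain ω₂ lam β γ).hamiltonian N x :=
    le_trans (Finset.single_le_sum (f := fun i => x.2 i ^ 2) (fun i _ => sq_nonneg _) (Finset.mem_univ b))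
      (pinnedChain_sum_sq_le_two_mul_hamiltonian hω hl hβ N x)
  nlinarith [sq_nonneg (x.2 b - s)]

/-- `(1 + H)⁴ e^{-H/T}` is Lebesgue integrable on phase space (Gaussian confinement). -/
theorem integrable_one_add_hamiltonian_pow_four_mul_exp (γ : ℝ) (N : ℕ) {T : ℝ} (hT : 0 < T) :
    Integrable fun x : PhaseSpace N => (1 + (pinnedChain ω₂ lam β γ).hamiltonian N x) ^ 4 *
      Real.exp (-((pinnedChain ω₂ lam β γ).hamiltonian N x) / T) := by
  set H := (pinnedChain ω₂ lam β γ).hamiltonian N with hH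
  have hc : 0 < T⁻¹ / 4 := by positivity
  have hc2 : 0 < T⁻¹ / 2 := by positivity
  set K : ℝ := 2 * Real.exp (T⁻¹ / 4) / (T⁻¹ / 4) ^ 2 with hK
  have hmaj := (pinnedChain_integrable_exp_neg_mul_hamiltonian hω hl hβ γ N hc2).const_mul (K ^ 2)
  have hcont : Continuous H := (pinnedChain_contDiff_hamiltonian ω₂ lam β γ N (n := 0)).continuous
  refine hmaj.mono' ?_ (Filter.Eventually.of_forall fun x => ?_)
  · have h1 : Continuous fun x : PhaseSpace N => (1 + H x) ^ 4 * Real.exp (-(H x) / T) := by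
      have := hcont
      fun_prop
    exact h1.aestronglyMeasurable
  · have hH0 : 0 ≤ H x := pinnedChain_hamiltonian_nonneg hω.le hl hβ γ N x
    have hsq := one_add_sq_le_exp hH0 hc
    have hK0 : 0 ≤ K := by positivity
    rw [Real.norm_eq_abs, abs_of_nonneg (by positivity)]
    have h4 : (1 + H x) ^ 4 ≤ K ^ 2 * Real.exp (T⁻¹ / 2 * H x) := by
      have : (1 + H x) ^ 4 = ((1 + H x) ^ 2) ^ 2 := by ring
      rw [this]
      calc ((1 + H x) ^ 2) ^ 2 ≤ (K * Real.exp (T⁻¹ / 4 * H x)) ^ 2 :=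
            pow_le_pow_left₀ (by positivity) hsq 2
        _ = K ^ 2 * Real.exp (T⁻¹ / 2 * H x) := by
            rw [mul_pow, ← Real.exp_nat_mul]; congr 1; congr 1; push_cast; ring
    calc (1 + H x) ^ 4 * Real.exp (-H x / T)
        ≤ K ^ 2 * Real.exp (T⁻¹ / 2 * H x) * Real.exp (-H x / T) :=
          mul_le_mul_of_nonneg_right h4 (Real.exp_pos _).le
      _ = K ^ 2 * Real.exp (-(T⁻¹ / 2 * H x)) := by
          rw [mul_assoc, ← Real.exp_add]; congr 1; congr 1; field_simp; ring


omit hω hl hβ in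
/-- The kick map `x ↦ (q, p + s e_b)` is continuous. -/
theorem continuous_kick {N : ℕ} (b : Fin N) (s : ℝ) :
    Continuous fun x : PhaseSpace N => (x.1, Function.update x.2 b (x.2 b + s)) := by
  have h : (fun x : PhaseSpace N => (x.1, Function.update x.2 b (x.2 b + s))) =
      fun x => (x.1, x.2 + Pi.single b s) := funext fun x => by rw [update_eq_add_single]
  rw [h]
  fun_prop

/-- The squared finite difference of the transported current is continuous in the initial point. -/
theorem continuous_sqDiff (γ : ℝ) (N : ℕ) (i b : Fin N) (t s : ℝ) :
    Continuous fun x : PhaseSpace N =>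
      ((pinnedChain ω₂ lam β γ).bondCurrent N i (detFlow ω₂ lam β N t (x.1, Function.update x.2 b (x.2 b + s))) -
        (pinnedChain ω₂ lam β γ).bondCurrent N i (detFlow ω₂ lam β N t x)) ^ 2 := by
  have hj := pinnedChain_continuous_bondCurrent ω₂ lam β γ N i
  have hΦ := continuous_detFlow hω hl hβ N t
  have hk := continuous_kick (N := N) b s
  exact ((hj.comp (hΦ.comp hk)).sub (hj.comp hΦ)).pow 2

/-- Pointwise majorant: `(Δ_s (j_i∘Φ_t))² ≤ 34 M² (1 + H)⁴`, `M = N(3+β)/2`, for `0 ≤ s ≤ 1`. -/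
theorem sqDiff_le (γ : ℝ) (N : ℕ) (i b : Fin N) {t : ℝ} (ht : 0 ≤ t) {s : ℝ} (hs0 : 0 ≤ s) (hs1 : s ≤ 1)
    (x : PhaseSpace N) :
    ((pinnedChain ω₂ lam β γ).bondCurrent N i (detFlow ω₂ lam β N t (x.1, Function.update x.2 b (x.2 b + s))) -
        (pinnedChain ω₂ lam β γ).bondCurrent N i (detFlow ω₂ lam β N t x)) ^ 2 ≤
      34 * (N * ((3 + β) / 2)) ^ 2 * (1 + (pinnedChain ω₂ lam β γ).hamiltonian N x) ^ 4 := by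
  set P := pinnedChain ω₂ lam β γ
  set y : PhaseSpace N := (x.1, Function.update x.2 b (x.2 b + s))
  set A := P.bondCurrent N i (detFlow ω₂ lam β N t y)
  set B := P.bondCurrent N i (detFlow ω₂ lam β N t x)
  set M : ℝ := N * ((3 + β) / 2)
  have hH0 : 0 ≤ P.hamiltonian N x := pinnedChain_hamiltonian_nonneg hω.le hl hβ γ N x
  have hHy0 : 0 ≤ P.hamiltonian N y := pinnedChain_hamiltonian_nonneg hω.le hl hβ γ N y
  have hA : |A| ≤ M * (1 + P.hamiltonian N y) ^ 2 := by
    have := abs_bondCurrent_detFlow_le hω hl hβ γ N i ht y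
    simpa [M, mul_assoc] using this
  have hB : |B| ≤ M * (1 + P.hamiltonian N x) ^ 2 := by
    have := abs_bondCurrent_detFlow_le hω hl hβ γ N i ht x
    simpa [M, mul_assoc] using this
  have hy : 1 + P.hamiltonian N y ≤ 2 * (1 + P.hamiltonian N x) := by
    have := hamiltonian_kick_le hω hl hβ γ N x b s
    have hs2 : s ^ 2 ≤ 1 := by nlinarith
    simp only [y] at this ⊢
    linarith
  have hM : 0 ≤ M := by positivity
  have hA2 : A ^ 2 ≤ M ^ 2 * (2 * (1 + P.hamiltonian N x)) ^ 4 := by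
    have h1 : A ^ 2 ≤ (M * (1 + P.hamiltonian N y) ^ 2) ^ 2 := by
      rw [← sq_abs A]; exact pow_le_pow_left₀ (abs_nonneg _) hA 2
    have h2 : (1 + P.hamiltonian N y) ^ 2 ≤ (2 * (1 + P.hamiltonian N x)) ^ 2 :=
      pow_le_pow_left₀ (by linarith) hy 2
    calc A ^ 2 ≤ (M * (1 + P.hamiltonian N y) ^ 2) ^ 2 := h1
      _ = M ^ 2 * ((1 + P.hamiltonian N y) ^ 2) ^ 2 := by ring
      _ ≤ M ^ 2 * ((2 * (1 + P.hamiltonian N x)) ^ 2) ^ 2 := by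
          gcongr
      _ = M ^ 2 * (2 * (1 + P.hamiltonian N x)) ^ 4 := by ring
  have hB2 : B ^ 2 ≤ M ^ 2 * (1 + P.hamiltonian N x) ^ 4 := by
    have h1 : B ^ 2 ≤ (M * (1 + P.hamiltonian N x) ^ 2) ^ 2 := by
      rw [← sq_abs B]; exact pow_le_pow_left₀ (abs_nonneg _) hB 2
    calc B ^ 2 ≤ (M * (1 + P.hamiltonian N x) ^ 2) ^ 2 := h1
      _ = M ^ 2 * (1 + P.hamiltonian N x) ^ 4 := by ring
  have hAB : (A - B) ^ 2 ≤ 2 * A ^ 2 + 2 * B ^ 2 := by nlinarith [sq_nonneg (A + B)]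
  calc (A - B) ^ 2 ≤ 2 * A ^ 2 + 2 * B ^ 2 := hAB
    _ ≤ 2 * (M ^ 2 * (2 * (1 + P.hamiltonian N x)) ^ 4) + 2 * (M ^ 2 * (1 + P.hamiltonian N x) ^ 4) := by
        gcongr
    _ = 34 * M ^ 2 * (1 + P.hamiltonian N x) ^ 4 := by ring

/-- The squared finite difference is integrable against the (unnormalised) Gibbs weight. -/
theorem integrable_sqDiff (γ : ℝ) (N : ℕ) (i b : Fin N) {t : ℝ} (ht : 0 ≤ t) {s : ℝ} (hs0 : 0 ≤ s)
    (hs1 : s ≤ 1) {T : ℝ} (hT : 0 < T) :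
    Integrable (fun x : PhaseSpace N =>
      ((pinnedChain ω₂ lam β γ).bondCurrent N i (detFlow ω₂ lam β N t (x.1, Function.update x.2 b (x.2 b + s))) -
        (pinnedChain ω₂ lam β γ).bondCurrent N i (detFlow ω₂ lam β N t x)) ^ 2)
      (volume.withDensity fun x : PhaseSpace N =>
        ENNReal.ofReal (Real.exp (-((pinnedChain ω₂ lam β γ).hamiltonian N x) / T))) := by
  set P := pinnedChain ω₂ lam β γ
  have hHc : Continuous (P.hamiltonian N) := (pinnedChain_contDiff_hamiltonian ω₂ lam β γ N (n := 0)).continuous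
  have hρm : Measurable fun x : PhaseSpace N => ENNReal.ofReal (Real.exp (-(P.hamiltonian N x) / T)) := by
    fun_prop
  rw [integrable_withDensity_iff_integrable_smul' hρm (Filter.Eventually.of_forall fun _ => ENNReal.ofReal_lt_top)]
  have hG := continuous_sqDiff hω hl hβ γ N i b t s
  refine ((integrable_one_add_hamiltonian_pow_four_mul_exp hω hl hβ γ N hT).const_mul
    (34 * (N * ((3 + β) / 2)) ^ 2)).mono' ?_ (Filter.Eventually.of_forall fun x => ?_)
  · refine (Continuous.aestronglyMeasurable ?_)
    have h1 : Continuous fun x : PhaseSpace N => (ENNReal.ofReal (Real.exp (-(P.hamiltonian N x) / T))).toReal := by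
      have : (fun x : PhaseSpace N => (ENNReal.ofReal (Real.exp (-(P.hamiltonian N x) / T))).toReal) =
          fun x => Real.exp (-(P.hamiltonian N x) / T) :=
        funext fun x => ENNReal.toReal_ofReal (Real.exp_pos _).le
      rw [this]; fun_prop
    exact h1.smul hG
  · rw [ENNReal.toReal_ofReal (Real.exp_pos _).le, smul_eq_mul, Real.norm_eq_abs, abs_mul,
      abs_of_pos (Real.exp_pos _), abs_of_nonneg (sq_nonneg _)]
    have hb := sqDiff_le hω hl hβ γ N i b ht hs0 hs1 x
    have he : 0 < Real.exp (-(P.hamiltonian N x) / T) := Real.exp_pos _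
    calc Real.exp (-(P.hamiltonian N x) / T) * _ ≤
        Real.exp (-(P.hamiltonian N x) / T) * (34 * (N * ((3 + β) / 2)) ^ 2 * (1 + P.hamiltonian N x) ^ 4) :=
          mul_le_mul_of_nonneg_left hb he.le
      _ = 34 * (N * ((3 + β) / 2)) ^ 2 * ((1 + P.hamiltonian N x) ^ 4 * Real.exp (-(P.hamiltonian N x) / T)) := by
          ring

omit hω hl hβ in
/-- **`E3` ⇒ the mean-square tangent cone bound** (Fatou along `s = 1/(n+1) → 0`). Any proof of
`ClosedConeSensitivity` is a proof of `TangentConeBound`; any `N`-non-uniformity of the Gibbs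
mean square of the tangent-map entry `∂_{p_b}(j_i∘Φ_t)` on the cone `t ≤ a d` refutes `E3`. -/
theorem tangentConeBound_of_closedConeSensitivity (hE3 : ClosedConeSensitivity) : TangentConeBound := by
  intro ω₂ lam β γ hω hl hβ hγ T hT
  obtain ⟨a, κ, C, ha, hκ, H⟩ := (closedConeSensitivity_iff_det.mp hE3) ω₂ lam β γ hω hl hβ hγ T hT
  refine ⟨a, κ, C, ha, hκ, fun N i b t hb ht => ?_⟩
  intro P μT d htd
  have hn : ∀ n : ℕ,
      ∫⁻ x, ENNReal.ofReal (((n : ℝ) + 1) ^ 2 *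
          (P.bondCurrent N i (detFlow ω₂ lam β N t (x.1, Function.update x.2 b (x.2 b + 1 / ((n : ℝ) + 1)))) -
            P.bondCurrent N i (detFlow ω₂ lam β N t x)) ^ 2) ∂μT
        ≤ ENNReal.ofReal (C * Real.exp (-(κ * ((d : ℝ) - t / a))) *
            ∫ x, Real.exp (-(P.hamiltonian N x) / T) ∂volume) := by
    intro n
    have hn0 : (0 : ℝ) < (n : ℝ) + 1 := by positivity
    have hs0 : (0 : ℝ) < 1 / ((n : ℝ) + 1) := by positivity
    have hs1 : 1 / ((n : ℝ) + 1) ≤ 1 := by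
      rw [div_le_one hn0]; linarith [n.cast_nonneg (α := ℝ)]
    have HE := H N i b t (1 / ((n : ℝ) + 1)) hb ht hs0 hs1 htd
    have hint := integrable_sqDiff hω hl.le hβ.le γ N i b ht hs0.le hs1 hT
    have hnn : 0 ≤ᵐ[μT] fun x => ((n : ℝ) + 1) ^ 2 *
        (P.bondCurrent N i (detFlow ω₂ lam β N t (x.1, Function.update x.2 b (x.2 b + 1 / ((n : ℝ) + 1)))) -
          P.bondCurrent N i (detFlow ω₂ lam β N t x)) ^ 2 :=
      Filter.Eventually.of_forall fun x => by positivity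
    rw [← ofReal_integral_eq_lintegral_ofReal (hint.const_mul _) hnn, integral_const_mul]
    apply ENNReal.ofReal_le_ofReal
    calc ((n : ℝ) + 1) ^ 2 * _ ≤ ((n : ℝ) + 1) ^ 2 * (C * (1 / ((n : ℝ) + 1)) ^ 2 *
          Real.exp (-(κ * ((d : ℝ) - t / a))) * ∫ x, Real.exp (-(P.hamiltonian N x) / T) ∂volume) :=
          mul_le_mul_of_nonneg_left HE (by positivity)
      _ = C * Real.exp (-(κ * ((d : ℝ) - t / a))) * ∫ x, Real.exp (-(P.hamiltonian N x) / T) ∂volume := by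
          field_simp
  have hmeas : ∀ n : ℕ, Measurable fun x : PhaseSpace N => ENNReal.ofReal (((n : ℝ) + 1) ^ 2 *
      (P.bondCurrent N i (detFlow ω₂ lam β N t (x.1, Function.update x.2 b (x.2 b + 1 / ((n : ℝ) + 1)))) -
        P.bondCurrent N i (detFlow ω₂ lam β N t x)) ^ 2) := fun n =>
    ((continuous_const.mul (continuous_sqDiff hω hl.le hβ.le γ N i b t (1 / ((n : ℝ) + 1)))).measurable).ennreal_ofReal
  calc _ ≤ Filter.liminf (fun n : ℕ => ∫⁻ x, ENNReal.ofReal (((n : ℝ) + 1) ^ 2 *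
          (P.bondCurrent N i (detFlow ω₂ lam β N t (x.1, Function.update x.2 b (x.2 b + 1 / ((n : ℝ) + 1)))) -
            P.bondCurrent N i (detFlow ω₂ lam β N t x)) ^ 2) ∂μT) Filter.atTop :=
        lintegral_liminf_le hmeas
    _ ≤ _ := Filter.liminf_le_of_frequently_le' (Filter.Eventually.of_forall hn).frequently


/-! ## §4 the refutation interface: blow-up of the tangent mean square on ONE ray kills `E3`

`TangentRayBlowup ω₂ lam β T`: for EVERY slope `a > 0` (time per bond) and every `C`, some bond `d`
of some chain length `N` has normalised tangent mean square on the ray `t = a·d` exceeding `C`: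
`Z⁻¹ ∫ liminf_n ((n+1) Δ_{1/(n+1)} (j_d ∘ Φ_{a d}))² e^{-H/T} > C` (kick at the contact `b = 0`).
This is what the hot-cluster mechanism of the module docstring predicts at every parameter point,
and what the kit jobs measure (`M2(d, a·d)` against `d`). One parameter point suffices. -/

/-- Blow-up of the Gibbs mean square of the tangent entry `∂_{p_0}(j_d∘Φ_t)` along every ray
`t = a·d` (Fatou/`liminf` form, kick at the left contact). -/
def TangentRayBlowup (ω₂ lam β T : ℝ) : Prop :=
  ∀ a : ℝ, 0 < a → ∀ C : ℝ, ∃ (N : ℕ) (i b : Fin N), b.val = 0 ∧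
    ENNReal.ofReal (C * ∫ x, Real.exp (-((pinnedChain ω₂ lam β 0).hamiltonian N x) / T) ∂volume) <
      ∫⁻ x, Filter.liminf (fun n : ℕ => ENNReal.ofReal (((n : ℝ) + 1) ^ 2 *
          ((pinnedChain ω₂ lam β 0).bondCurrent N i
              (detFlow ω₂ lam β N (a * i.val) (x.1, Function.update x.2 b (x.2 b + 1 / ((n : ℝ) + 1)))) -
            (pinnedChain ω₂ lam β 0).bondCurrent N i (detFlow ω₂ lam β N (a * i.val) x)) ^ 2)) Filter.atTop
        ∂(volume.withDensity fun x : PhaseSpace N =>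
            ENNReal.ofReal (Real.exp (-((pinnedChain ω₂ lam β 0).hamiltonian N x) / T)))

omit hl hβ in
/-- **Refutation skeleton.** Ray blow-up of the tangent mean square at ONE admissible parameter
point refutes `E3` (through `tangentConeBound_of_closedConeSensitivity`, on the ray `t = a·d` the
claimed bound is `C · Z`, uniformly in `d`). The antecedent is the open dynamical input (rigorous
energy-growing Lyapunov exponents of small quartic clusters + persistence); see the module
docstring for why it is expected and the kit jobs for its numerical trace. -/
theorem closedConeSensitivity_false_of_rayBlowup {γ T : ℝ} (hγ : 0 < γ) (hl' : 0 < lam) (hβ' : 0 < β)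
    (hT : 0 < T) (hblow : TangentRayBlowup ω₂ lam β T) : ¬ ClosedConeSensitivity := by
  intro hE3
  obtain ⟨a, κ, C, ha, hκ, H⟩ := tangentConeBound_of_closedConeSensitivity hE3 ω₂ lam β γ hω hl' hβ' hγ T hT
  obtain ⟨N, i, b, hb, hlt⟩ := hblow a ha C
  have ht : 0 ≤ a * (i.val : ℝ) := by positivity
  have H' := H N i b (a * i.val) (Or.inl hb) ht
  simp only [hb, ↓reduceIte] at H'
  have H'' := H' le_rfl
  have hexp : Real.exp (-(κ * ((i.val : ℝ) - a * (i.val : ℝ) / a))) = 1 := by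
    rw [show a * (i.val : ℝ) / a = (i.val : ℝ) by field_simp, sub_self, mul_zero, neg_zero, Real.exp_zero]
  rw [hexp, mul_one, hamiltonian_indep_friction, bondCurrent_indep_friction] at H''
  exact absurd (lt_of_lt_of_le hlt H'') (lt_irrefl _)


omit hl hβ in
/-- **The edge consequence.** `E3` bounds the normalised tangent mean square ON the cone boundary
`t = a·d` uniformly in the chain length and in the bond: `∃ a C, ∀ N d,
∫ liminf_n ((n+1)Δ_{1/(n+1)}(j_d∘Φ_{ad}))² e^{-H/T} ≤ C·Z_N` (kick at the left contact). This is the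
single most falsifiable prediction of `E3` (kit jobs: `M2(d, a·d)` against `d`). -/
theorem edgeBound_of_closedConeSensitivity (hE3 : ClosedConeSensitivity) {γ T : ℝ} (hγ : 0 < γ)
    (hl' : 0 < lam) (hβ' : 0 < β) (hT : 0 < T) :
    ∃ a C : ℝ, 0 < a ∧ ∀ (N : ℕ) (i b : Fin N), b.val = 0 →
      ∫⁻ x, Filter.liminf (fun n : ℕ => ENNReal.ofReal (((n : ℝ) + 1) ^ 2 *
          ((pinnedChain ω₂ lam β 0).bondCurrent N i
              (detFlow ω₂ lam β N (a * i.val) (x.1, Function.update x.2 b (x.2 b + 1 / ((n : ℝ) + 1)))) -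
            (pinnedChain ω₂ lam β 0).bondCurrent N i (detFlow ω₂ lam β N (a * i.val) x)) ^ 2)) Filter.atTop
        ∂(volume.withDensity fun x : PhaseSpace N =>
            ENNReal.ofReal (Real.exp (-((pinnedChain ω₂ lam β 0).hamiltonian N x) / T)))
      ≤ ENNReal.ofReal (C * ∫ x, Real.exp (-((pinnedChain ω₂ lam β 0).hamiltonian N x) / T) ∂volume) := by
  obtain ⟨a, κ, C, ha, hκ, H⟩ := tangentConeBound_of_closedConeSensitivity hE3 ω₂ lam β γ hω hl' hβ' hγ T hT
  refine ⟨a, C, ha, fun N i b hb => ?_⟩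
  have ht : 0 ≤ a * (i.val : ℝ) := by positivity
  have H' := H N i b (a * i.val) (Or.inl hb) ht
  simp only [hb, ↓reduceIte] at H'
  have H'' := H' le_rfl
  have hexp : Real.exp (-(κ * ((i.val : ℝ) - a * (i.val : ℝ) / a))) = 1 := by
    rw [show a * (i.val : ℝ) / a = (i.val : ℝ) by field_simp, sub_self, mul_zero, neg_zero, Real.exp_zero]
  rw [hexp, mul_one, hamiltonian_indep_friction, bondCurrent_indep_friction] at H''
  exact H''

/-! ## §5 load-bearing hypotheses and natural variants (which proofs must use what)

* `0 < lam`, `0 < β` are NOT load-bearing for `E3` itself: the crux docstring (and the linear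
  tangent map `e^{tA}` with Bessel-type tails outside the sound cone, `v_s < 1/a`) make `E3` TRUE for
  the harmonic member — `E3` is kinematic. Anharmonicity is what ENDANGERS it (unbounded curvature ⇒
  unbounded local stretching rates ⇒ intermittent tangent growth in `L²(Gibbs)`), the opposite of
  the usual role of `lam, β > 0` in this route.
* `s ≤ 1` IS load-bearing: `ClosedConeSensitivityAllKicks` below is false (large kicks make the
  neighbouring current scale like `s^{5/2}` at times `O(1)`), recorded as a near-miss (`sorry`: needs
  quantitative short-time control of the nonlinear flow, not chaos).
* `t ≤ a·d` (the cone): dropping it (`…NoCone`) asks for at most EXPONENTIAL growth in `t` of the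
  Gibbs mean-square tangent entry at FIXED `d`; the hot-cluster mechanism predicts `exp(c t^{4/3})`
  (sup over cluster energy `e` of `e^{2 c e^{1/4} t - k e/T}`), so conjecturally false; status open,
  measured by the kit jobs (`M2(d ≤ 3, t)` against `t`).
* The factor `s²`: dropping it (`…BoundedGain`, the planner's "bounded gain" reading) gives a
  statement implied by `E3`, plausibly TRUE (gain bounded by energy, cone from BCDM/Buttà–Marchioro
  type estimates in mean square) — and USELESS for `WitnessGlue`, whose leak term is
  `γT Σ_b ⟨∂_{p_b} u⁺, ∂_{p_b}(j_i∘Φ_t)⟩`, a pairing with the DERIVATIVE. -/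

/-- `E3` without the kick-size cap `s ≤ 1`. -/
def ClosedConeSensitivityAllKicks : Prop :=
  ∀ ω₂ lam β γ : ℝ, 0 < ω₂ → 0 < lam → 0 < β → 0 < γ → ∀ T : ℝ, 0 < T → ∃ a κ C : ℝ, 0 < a ∧ 0 < κ ∧
    ∀ (N : ℕ) (i b : Fin N) (t s : ℝ), (b.val = 0 ∨ b.val = N - 1) → 0 ≤ t → 0 < s →
      let P := pinnedChain ω₂ lam β γ
      let μT : Measure (PhaseSpace N) :=
        volume.withDensity (fun x => ENNReal.ofReal (Real.exp (-(P.hamiltonian N x) / T)))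
      let d : ℕ := (if b.val = 0 then i.val else N - 2 - i.val)
      t ≤ a * (d : ℝ) →
        ∫ x, (P.bondCurrent N i (detFlow ω₂ lam β N t (x.1, Function.update x.2 b (x.2 b + s))) -
              P.bondCurrent N i (detFlow ω₂ lam β N t x)) ^ 2 ∂μT
          ≤ C * s ^ 2 * Real.exp (-(κ * ((d : ℝ) - t / a))) * ∫ x, Real.exp (-(P.hamiltonian N x) / T) ∂volume

/-- `E3` without the cone restriction `t ≤ a·d` (the right-hand side then grows like `e^{κ t/a}`). -/
def ClosedConeSensitivityNoCone : Prop :=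
  ∀ ω₂ lam β γ : ℝ, 0 < ω₂ → 0 < lam → 0 < β → 0 < γ → ∀ T : ℝ, 0 < T → ∃ a κ C : ℝ, 0 < a ∧ 0 < κ ∧
    ∀ (N : ℕ) (i b : Fin N) (t s : ℝ), (b.val = 0 ∨ b.val = N - 1) → 0 ≤ t → 0 < s → s ≤ 1 →
      let P := pinnedChain ω₂ lam β γ
      let μT : Measure (PhaseSpace N) :=
        volume.withDensity (fun x => ENNReal.ofReal (Real.exp (-(P.hamiltonian N x) / T)))
      let d : ℕ := (if b.val = 0 then i.val else N - 2 - i.val)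
        ∫ x, (P.bondCurrent N i (detFlow ω₂ lam β N t (x.1, Function.update x.2 b (x.2 b + s))) -
              P.bondCurrent N i (detFlow ω₂ lam β N t x)) ^ 2 ∂μT
          ≤ C * s ^ 2 * Real.exp (-(κ * ((d : ℝ) - t / a))) * ∫ x, Real.exp (-(P.hamiltonian N x) / T) ∂volume

/-- The bounded-gain weakening of `E3`: no factor `s²` (kicks `s ∈ (0,1]`). -/
def ClosedConeSensitivityBoundedGain : Prop :=
  ∀ ω₂ lam β γ : ℝ, 0 < ω₂ → 0 < lam → 0 < β → 0 < γ → ∀ T : ℝ, 0 < T → ∃ a κ C : ℝ, 0 < a ∧ 0 < κ ∧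
    ∀ (N : ℕ) (i b : Fin N) (t s : ℝ), (b.val = 0 ∨ b.val = N - 1) → 0 ≤ t → 0 < s → s ≤ 1 →
      let P := pinnedChain ω₂ lam β γ
      let μT : Measure (PhaseSpace N) :=
        volume.withDensity (fun x => ENNReal.ofReal (Real.exp (-(P.hamiltonian N x) / T)))
      let d : ℕ := (if b.val = 0 then i.val else N - 2 - i.val)
      t ≤ a * (d : ℝ) →
        ∫ x, (P.bondCurrent N i (detFlow ω₂ lam β N t (x.1, Function.update x.2 b (x.2 b + s))) -
              P.bondCurrent N i (detFlow ω₂ lam β N t x)) ^ 2 ∂μT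
          ≤ C * Real.exp (-(κ * ((d : ℝ) - t / a))) * ∫ x, Real.exp (-(P.hamiltonian N x) / T) ∂volume

omit hω hl hβ in
/-- The two strengthenings imply `E3` (bookkeeping). -/
theorem closedConeSensitivity_of_allKicks (h : ClosedConeSensitivityAllKicks) : ClosedConeSensitivity := by
  rw [closedConeSensitivity_iff_det]
  intro ω₂ lam β γ hω hl hβ hγ T hT
  obtain ⟨a, κ, C, ha, hκ, H⟩ := h ω₂ lam β γ hω hl hβ hγ T hT
  exact ⟨a, κ, C, ha, hκ, fun N i b t s hb ht hs _ => H N i b t s hb ht hs⟩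

omit hω hl hβ in
theorem closedConeSensitivity_of_noCone (h : ClosedConeSensitivityNoCone) : ClosedConeSensitivity := by
  rw [closedConeSensitivity_iff_det]
  intro ω₂ lam β γ hω hl hβ hγ T hT
  obtain ⟨a, κ, C, ha, hκ, H⟩ := h ω₂ lam β γ hω hl hβ hγ T hT
  exact ⟨a, κ, C, ha, hκ, fun N i b t s hb ht hs hs1 _ => H N i b t s hb ht hs hs1⟩

omit hω hl hβ in
/-- `E3` implies its bounded-gain weakening (with the constant `max C 0`). -/
theorem boundedGain_of_closedConeSensitivity (h : ClosedConeSensitivity) : ClosedConeSensitivityBoundedGain := by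
  rw [closedConeSensitivity_iff_det] at h
  intro ω₂ lam β γ hω hl hβ hγ T hT
  obtain ⟨a, κ, C, ha, hκ, H⟩ := h ω₂ lam β γ hω hl hβ hγ T hT
  refine ⟨a, κ, max C 0, ha, hκ, fun N i b t s hb ht hs hs1 => ?_⟩
  intro P μT d htd
  have H' := H N i b t s hb ht hs hs1 htd
  have hZ : 0 ≤ ∫ x, Real.exp (-(P.hamiltonian N x) / T) ∂volume :=
    integral_nonneg fun x => (Real.exp_pos _).le
  have he : 0 ≤ Real.exp (-(κ * ((d : ℝ) - t / a))) := (Real.exp_pos _).le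
  have hs2 : s ^ 2 ≤ 1 := by nlinarith
  calc _ ≤ C * s ^ 2 * Real.exp (-(κ * ((d : ℝ) - t / a))) * ∫ x, Real.exp (-(P.hamiltonian N x) / T) ∂volume := H'
    _ ≤ max C 0 * s ^ 2 * Real.exp (-(κ * ((d : ℝ) - t / a))) * ∫ x, Real.exp (-(P.hamiltonian N x) / T) ∂volume := by
        gcongr; exact le_max_left _ _
    _ ≤ max C 0 * 1 * Real.exp (-(κ * ((d : ℝ) - t / a))) * ∫ x, Real.exp (-(P.hamiltonian N x) / T) ∂volume := by
        gcongr
    _ = _ := by rw [mul_one]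

/-- NEAR-MISS (conjecturally provable by short-time perturbation theory, NOT attempted formally:
needs quantitative control of the nonlinear flow on `[0, a]` for large data). `s ≤ 1` is
load-bearing: for `d = 1` (`i = 1`, `b = 0`) and fixed `t ∈ (0, a]`, a kick `s → ∞` at `p_0`
drives `q_0` to amplitude `≍ s^{1/2}` within time `≍ s^{-1/2}`, the bond force `β(q_0 - q_1)³ ≍ s^{3/2}`
pumps `p_1` to `≍ s` and `q_1` to `≍ s^{1/2}`, so `j_1 = -(p_1+p_2)/2 · V'(q_2 - q_1) ≍ s^{5/2}` and
`∫ (Δ_s j_1∘Φ_t)² dμ_T ≍ s⁵ Z ≫ C s² Z`. Obstruction to a Lean proof: no quantitative ODE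
enclosure for the pinned chain in the tree (only existence, continuity, energy bounds). -/
theorem not_closedConeSensitivityAllKicks : ¬ ClosedConeSensitivityAllKicks := by
  sorry

end Summit.AtomisticToContinuum.FouriersLaw.Cruxes.ClosedConeSensitivity.Disproof
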